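import Summits.QuantumFields.BalabanUV.T4Continuum.Support.VariationalColourInterpolant
import Summits.QuantumFields.BalabanUV.T4Continuum.Support.VariationalCovariantOneStep

/-!
# T⁴ programme, spine node NE2 (U1a), lane P2 — SUPPLIER ITEM (O8) «V-COL-ONE», PART 2: THE ONE-STEP CONSISTENCY BOUND IN LATTICE UNITS FOR
# 0-FORMS WITH VALUES IN A HILBERT SPACE `E` (the colour cross-term identity, block sums with the main term's constant EXACTLY 1, the lattice
# END) — the colour re-run of leaf ONE⁺ part 2 `VariationalCovariantOneStep` (leaf-01-g2, p213246)

NE2 formalisation swarm `b2b-balaban-t4-ne2-formalise-*`, leaf prover 02 (gen 4); P2 skeleton `t4/skeletons/NE2-t4-ne2-p2.md` v0.10 §2.E row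
V-COL, member ONE⁺.  Part 1 (`VariationalColourInterpolant`): the competitor `Λ′ = T′⋆ Φ`, exact constraint `Qcv_interpv`, exact bond increments,
the frame split, the pointwise bound `norm_cDv_interpv_le`, the size `sum_norm_sq_PhiFv_le`.  The pure-ℝ weight bookkeeping
(`VariationalCovariantWeights.{wt, neg_wt_zero_mem, sum_ind_last, sum_ind_wt_update}`, `VariationalCovariantOneStep.pow_pred_eq`) and the ℝ-side
(`VariationalCovariantFederbush.{sq_sum_le_card_mul, sum_sq_add_le, sum_fin_sq_add_le}`) are imported BY NAME.

THE STATEMENTS (lattice units; `X = Σ_μ dirUv N Rc λ μ`, `HESS = hessv N Rc λ`, `Y = Σ_y ‖λ y‖²`; site operators `T′` and coarse bond operators `Rc`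
UNITARY, fine bond operators `R′` data, the two FRAME defects `‖R′(x,μ)∘T′(x+e_μ)⋆ − T′(x)⋆‖ ≤ m` (in-block), `‖R′(x,μ)∘T′(x+e_μ)⋆ − T′(x)⋆∘Rc(y,μ)‖ ≤ m`
(crossing)):

  `Σ_μ dirUv (fine L N) R′ Λ′ μ ≤ ( √( L^d∕L²·X + (d∕4 + 1∕2)·L^d∕L·HESS ) + √d·m·√(2(1+d²)·L^d·Y) )²`        (`sum_dirUv_interpv_le`)

— the MAIN TERM `L^d∕L²·X` has constant EXACTLY 1: the main × second-order cross term is `+L^{d−2}·(L−1)∕(2L)·Σ_y‖(D⁺_μD⁺_μλ)(y)‖² ≥ 0` by the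
COLOUR CROSS-TERM IDENTITY `Re Σ_y ⟪G y, (D⁺_μ G)(y)⟫ = −½·Σ_y ‖(D⁺_μ G)(y)‖²` (§1, unitary `Rc(·,μ)`: `‖Rc v‖ = ‖v‖` + translation invariance —
the E-valued twin of `VariationalCovariantWeights.re_sum_conj_mul_cD`), NOT by Cauchy–Schwarz.  SAME constants as the scalar leaf.  Also §1
`norm_frameDefect_eq` (`‖R∘T(x′)⋆ − T(x)⋆‖ = ‖R∘T(x′)⋆∘T(x) − 1‖`: the in-block FRAME defect IS the UB⁺-colour defect in norm).
Part 3 (`VariationalColourOneStepPhys`): physical units and the `blockSpin` reading.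

HONEST FRAMING (T4-DAG p. 1).  Model level (operators DATA; no identification with Bałaban's `U(Γ)`, `Ū`, `U′` — c5); [folklore]; nothing
printed is a hypothesis; no `def`; no `sorry`; axioms standard.  ONE block step — no tower (the composition caveats N-ne2p2g11-2 ∕ G-ne2leaf04g2-1
apply to any colour tower).  NE2 NOT proved; spine PROVED 0∕9; rung (B)+1 finite T⁴ — NOT infinite volume, NOT a mass gap, NOT Clay.  HONEST
DEPENDENCY (cell, verbatim): continuum YM on T⁴ ⇐ BetaPertH ∧ nine spine estimates (0/9 proved); BetaPertH ⇐ (D1) ∧ (D4) ∧ CAP+tail; G-an2-4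
gates asym, D1 and NE2/3/4.
-/

noncomputable section

namespace Summit.QuantumFields.BalabanUV.T4Continuum.VariationalColourOneStep

open Finset
open scoped InnerProductSpace
open Literature.MathematicalPhysics.QuantumFieldTheory.Balaban1983to89
open Literature.MathematicalPhysics.QuantumFieldTheory.Balaban1983to89.B5Prop11Plancherel (Tor fine unitVec)
open Literature.MathematicalPhysics.QuantumFieldTheory.Balaban1983to89.B5Block118 (bpt)
open Literature.MathematicalPhysics.QuantumFieldTheory.Balaban1983to89.B5AverageCurlStokes (sum_blocks_real sum_translate)
open Summit.QuantumFields.BalabanUV.T4Continuum.VariationalCovariantFederbush (sq_sum_le_card_mul sum_sq_add_le sum_fin_sq_add_le)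
open Summit.QuantumFields.BalabanUV.T4Continuum.VariationalColourFederbush (cDv dirUv Qcv dirUv_nonneg norm_le_one_of_mem_unitary)
open Summit.QuantumFields.BalabanUV.T4Continuum.VariationalCovariantWeights (wt neg_wt_zero_mem sum_ind_last sum_ind_wt_update)
open Summit.QuantumFields.BalabanUV.T4Continuum.VariationalCovariantOneStep (pow_pred_eq)
open Summit.QuantumFields.BalabanUV.T4Continuum.VariationalColourInterpolant
  (Phiv PhiFv interpv hessv hessv_nonneg PhiFv_bpt Qcv_interpv err2v norm_cDv_interpv_le norm_err2v_le sum_norm_sq_PhiFv_le norm_star_apply_le)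

variable {d : ℕ} {E : Type*} [NormedAddCommGroup E] [InnerProductSpace ℂ E] [CompleteSpace E]

/-! ## §1 Unitary bookkeeping and the colour cross-term identity -/

section Cross

variable (N : Fin d → ℕ) [∀ μ, NeZero (N μ)]

/-- `‖U v‖ = ‖v‖` for unitary `U` (from `‖U‖, ‖U⋆‖ ≤ 1` and `U⋆U = 1`). [folklore] -/
theorem norm_apply_of_mem_unitary {U : E →L[ℂ] E} (hU : U ∈ unitary (E →L[ℂ] E)) (v : E) : ‖U v‖ = ‖v‖ := by
  have h1 : ‖U v‖ ≤ ‖v‖ := (ContinuousLinearMap.le_opNorm _ _).trans (mul_le_of_le_one_left (norm_nonneg _) (norm_le_one_of_mem_unitary hU))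
  have h2 : ‖v‖ ≤ ‖U v‖ := by
    have e : star U (U v) = v := by
      have h := congrArg (fun S : E →L[ℂ] E => S v) (Unitary.mem_iff.mp hU).1
      simpa only [mul_apply_eq_comp, one_apply_eq_self] using h
    calc ‖v‖ = ‖star U (U v)‖ := by rw [e]
      _ ≤ ‖U v‖ := norm_star_apply_le (E := E) hU (U v)
  exact le_antisymm h1 h2

/-- the FRAME form and the UB⁺ form of the in-block defect have the same norm for unitary `T(x)`:
`‖R ∘ T(x′)⋆ − T(x)⋆‖ = ‖R ∘ T(x′)⋆ ∘ T(x) − 1‖`. [folklore] -/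
theorem norm_frameDefect_eq {Tx : E →L[ℂ] E} (hTx : Tx ∈ unitary (E →L[ℂ] E)) (R Sx' : E →L[ℂ] E) :
    ‖R * Sx' - star Tx‖ = ‖R * Sx' * Tx - 1‖ := by
  obtain ⟨h1, h2⟩ := Unitary.mem_iff.mp hTx
  have e1 : R * Sx' * Tx - 1 = (R * Sx' - star Tx) * Tx := by rw [sub_mul, h1]
  have e2 : R * Sx' - star Tx = (R * Sx' * Tx - 1) * star Tx := by rw [sub_mul, mul_assoc, h2, mul_one, one_mul]
  refine le_antisymm ?_ ?_
  · rw [e2]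
    exact (norm_mul_le _ _).trans (mul_le_of_le_one_right (norm_nonneg _) (by rw [norm_star]; exact norm_le_one_of_mem_unitary hTx))
  · rw [e1]
    exact (norm_mul_le _ _).trans (mul_le_of_le_one_right (norm_nonneg _) (norm_le_one_of_mem_unitary hTx))

/-- for unitary bond operators, `2·Re Σ_y ⟪G y, (D⁺_μ G)(y)⟫ + Σ_y ‖(D⁺_μ G)(y)‖² = 0` (expand the square; the shifted mass equals the mass by
translation invariance of the torus sum and `‖Rc v‖ = ‖v‖`). [folklore] -/
theorem two_re_sum_inner_cDv_add {Rc : Tor N → Fin d → (E →L[ℂ] E)} (μ : Fin d) (hRc1 : ∀ y, Rc y μ ∈ unitary (E →L[ℂ] E))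
    (G : Tor N → E) :
    2 * (∑ y, ⟪G y, cDv N Rc G y μ⟫_ℂ).re + ∑ y, ‖cDv N Rc G y μ‖ ^ 2 = 0 := by
  have hshift : ∑ y : Tor N, ‖G (y + unitVec N μ)‖ ^ 2 = ∑ y : Tor N, ‖G y‖ ^ 2 :=
    Fintype.sum_equiv (Equiv.addRight (unitVec N μ)) _ _ fun y => rfl
  have h1 : ∀ y, ‖cDv N Rc G y μ‖ ^ 2
      = ‖G (y + unitVec N μ)‖ ^ 2 + ‖G y‖ ^ 2 - 2 * (⟪G y, Rc y μ (G (y + unitVec N μ))⟫_ℂ).re := by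
    intro y
    unfold cDv
    rw [@norm_sub_sq ℂ, norm_apply_of_mem_unitary (hRc1 y), ← inner_conj_symm, RCLike.conj_re]
    simp only [RCLike.re_to_complex]
    ring
  have h2 : ∀ y, (⟪G y, cDv N Rc G y μ⟫_ℂ).re = (⟪G y, Rc y μ (G (y + unitVec N μ))⟫_ℂ).re - ‖G y‖ ^ 2 := by
    intro y
    unfold cDv
    rw [inner_sub_right, Complex.sub_re]
    have : (⟪G y, G y⟫_ℂ).re = ‖G y‖ ^ 2 := by
      have h := inner_self_eq_norm_sq (𝕜 := ℂ) (G y)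
      simpa only [RCLike.re_to_complex] using h
    rw [this]
  rw [Complex.re_sum]
  simp_rw [h2, h1]
  rw [Finset.sum_sub_distrib, Finset.sum_sub_distrib, Finset.sum_add_distrib, hshift, ← Finset.mul_sum]
  ring

/-- **THE COLOUR CROSS-TERM IDENTITY**: `Re Σ_y ⟪G y, (D⁺_μ G)(y)⟫ = −½·Σ_y ‖(D⁺_μ G)(y)‖²` for unitary bond operators. [folklore] -/
theorem re_sum_inner_cDv {Rc : Tor N → Fin d → (E →L[ℂ] E)} (μ : Fin d) (hRc1 : ∀ y, Rc y μ ∈ unitary (E →L[ℂ] E)) (G : Tor N → E) :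
    (∑ y, ⟪G y, cDv N Rc G y μ⟫_ℂ).re = -(1 / 2) * ∑ y, ‖cDv N Rc G y μ‖ ^ 2 := by
  have h := two_re_sum_inner_cDv_add N μ hRc1 G
  linarith

end Cross


/-! ## §2 Block sums of the geometric part: main term EXACTLY `L^d∕L²·‖D⁺_μλ(y)‖²`, cross term ≥ 0 and second order, error second order -/

section Lattice

variable (L : ℕ) [NeZero L] (N : Fin d → ℕ) [∀ μ, NeZero (N μ)] (Rc : Tor N → Fin d → (E →L[ℂ] E)) (lam : Tor N → E)

omit [∀ μ, NeZero (N μ)] [CompleteSpace E] in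
/-- the block sum of the second-order parts is a single second difference: `Σ_j err₂(y,j,μ) = (L^{d−1}·w_L(0)) • (D⁺_μD⁺_μλ)(y)`
(the mixed directions cancel by the centring of the weights, `sum_ind_wt_update`). [folklore] -/
theorem sum_err2v (y : Tor N) (μ : Fin d) :
    ∑ j : Fin d → Fin L, err2v L N Rc lam y j μ
      = ((((L : ℝ) ^ (d - 1) * wt L 0) : ℝ) : ℂ) • cDv N Rc (fun z => cDv N Rc lam z μ) y μ := by
  classical
  set DD : Fin d → E := fun ν => cDv N Rc (fun z => cDv N Rc lam z ν) y μ with hDD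
  have h1 : ∀ j : Fin d → Fin L, err2v L N Rc lam y j μ
      = ∑ ν, (((if (j μ : ℕ) + 1 = L then (1 : ℝ) else 0) * wt L (Function.update j μ (0 : Fin L) ν) : ℝ) : ℂ) • DD ν := by
    intro j
    unfold err2v
    split_ifs with h
    · exact Finset.sum_congr rfl fun ν _ => by rw [one_mul]
    · symm
      exact Finset.sum_eq_zero fun ν _ => by rw [zero_mul, Complex.ofReal_zero, zero_smul]
  rw [Finset.sum_congr rfl fun j _ => h1 j, Finset.sum_comm]
  have h2 : ∀ ν : Fin d, ∑ j : Fin d → Fin L,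
      (((if (j μ : ℕ) + 1 = L then (1 : ℝ) else 0) * wt L (Function.update j μ (0 : Fin L) ν) : ℝ) : ℂ) • DD ν
      = (((if ν = μ then (L : ℝ) ^ (d - 1) * wt L 0 else 0) : ℝ) : ℂ) • DD ν := by
    intro ν
    rw [← Finset.sum_smul, ← Complex.ofReal_sum, sum_ind_wt_update L μ ν]
  rw [Finset.sum_congr rfl fun ν _ => h2 ν]
  have h3 : ∀ ν : Fin d, (((if ν = μ then (L : ℝ) ^ (d - 1) * wt L 0 else 0) : ℝ) : ℂ) • DD ν
      = if ν = μ then ((((L : ℝ) ^ (d - 1) * wt L 0) : ℝ) : ℂ) • DD ν else 0 := by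
    intro ν; split_ifs <;> simp
  rw [Finset.sum_congr rfl fun ν _ => h3 ν, Finset.sum_ite_eq' Finset.univ μ, if_pos (Finset.mem_univ μ)]

omit [∀ μ, NeZero (N μ)] [CompleteSpace E] in
/-- the block sum of the squared second-order parts: `Σ_j ‖err₂(y,j,μ)‖² ≤ L^{d−1}·(d∕4)·Σ_ν ‖(D⁺_μD⁺_νλ)(y)‖²`. [folklore] -/
theorem sum_norm_err2v_sq_le (y : Tor N) (μ : Fin d) :
    ∑ j : Fin d → Fin L, ‖err2v L N Rc lam y j μ‖ ^ 2
      ≤ (L : ℝ) ^ (d - 1) * ((d : ℝ) / 4 * ∑ ν, ‖cDv N Rc (fun z => cDv N Rc lam z ν) y μ‖ ^ 2) := by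
  set b : Fin d → ℝ := fun ν => ‖cDv N Rc (fun z => cDv N Rc lam z ν) y μ‖ with hb
  have hcs : (∑ ν, b ν) ^ 2 ≤ d * ∑ ν, b ν ^ 2 := by
    have h := sq_sum_le_card_mul (Finset.univ : Finset (Fin d)) b
    rwa [Finset.card_univ, Fintype.card_fin] at h
  have hB : 0 ≤ (d : ℝ) / 4 * ∑ ν, b ν ^ 2 := by positivity
  have hpt : ∀ j : Fin d → Fin L, ‖err2v L N Rc lam y j μ‖ ^ 2
      ≤ (if (j μ : ℕ) + 1 = L then (1 : ℝ) else 0) * ((d : ℝ) / 4 * ∑ ν, b ν ^ 2) := by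
    intro j
    have h := norm_err2v_le L N Rc lam y j μ
    split_ifs at h ⊢ with hj
    · rw [one_mul] at h ⊢
      have h2 := pow_le_pow_left₀ (norm_nonneg _) h 2
      refine h2.trans ?_
      rw [mul_pow]
      nlinarith [hcs]
    · rw [zero_mul] at h ⊢
      have : ‖err2v L N Rc lam y j μ‖ = 0 := le_antisymm h (norm_nonneg _)
      rw [this]; norm_num
  calc ∑ j : Fin d → Fin L, ‖err2v L N Rc lam y j μ‖ ^ 2
      ≤ ∑ j : Fin d → Fin L, (if (j μ : ℕ) + 1 = L then (1 : ℝ) else 0) * ((d : ℝ) / 4 * ∑ ν, b ν ^ 2) :=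
        Finset.sum_le_sum fun j _ => hpt j
    _ = (L : ℝ) ^ (d - 1) * ((d : ℝ) / 4 * ∑ ν, b ν ^ 2) := by rw [← Finset.sum_mul, sum_ind_last L μ]

/-- **THE GEOMETRIC PART, SUMMED** (unitary coarse operators in direction `μ`): with `G = D⁺_μλ`,
`Σ_y Σ_j ‖(1∕L)•G(y) + err₂(y,j,μ)‖² ≤ L^d∕L²·Σ_y‖G(y)‖² + (d∕4 + 1∕2)·L^d∕L·Σ_ν Σ_y ‖(D⁺_μD⁺_νλ)(y)‖²`.
The expansion is EXACT: main `L^d∕L²·X_μ` (constant 1), cross `= +L^{d−2}(L−1)∕(2L)·Σ_y‖(D⁺_μD⁺_μλ)(y)‖²` (`sum_err2v` + `re_sum_inner_cDv`),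
error by `sum_norm_err2v_sq_le`. [folklore] -/
theorem sum_geo_sq_le (μ : Fin d) (hRc1 : ∀ y, Rc y μ ∈ unitary (E →L[ℂ] E)) :
    ∑ y : Tor N, ∑ j : Fin d → Fin L, ‖((L : ℂ))⁻¹ • cDv N Rc lam y μ + err2v L N Rc lam y j μ‖ ^ 2
      ≤ (L : ℝ) ^ d / (L : ℝ) ^ 2 * dirUv N Rc lam μ
        + ((d : ℝ) / 4 + 1 / 2) * ((L : ℝ) ^ d / L) * ∑ ν, dirUv N Rc (fun z => cDv N Rc lam z ν) μ := by
  classical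
  have hL1 : 1 ≤ L := Nat.one_le_iff_ne_zero.mpr (NeZero.ne L)
  have hL : (0 : ℝ) < L := by exact_mod_cast hL1
  obtain ⟨hpow, hpowle⟩ := pow_pred_eq (d := d) L μ hL1
  obtain ⟨hw0, hw1⟩ := neg_wt_zero_mem L
  have hcard : ((Finset.univ : Finset (Fin d → Fin L)).card : ℝ) = (L : ℝ) ^ d := by
    rw [Finset.card_univ, Fintype.card_fun, Fintype.card_fin, Fintype.card_fin]; push_cast; ring
  -- names
  set G : Tor N → E := fun z => cDv N Rc lam z μ with hG
  set DD : Fin d → Tor N → E := fun ν y => cDv N Rc (fun z => cDv N Rc lam z ν) y μ with hDD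
  set c : ℝ := (L : ℝ) ^ (d - 1) * wt L 0 with hc
  have hDDμ : ∀ y, DD μ y = cDv N Rc G y μ := fun y => rfl
  -- per block: exact expansion `Σ_j ‖a + e_j‖² = L^d‖a‖² + Σ_j‖e_j‖² + 2·Re⟪a, Σ_j e_j⟫`
  have hblock : ∀ y : Tor N, ∑ j : Fin d → Fin L, ‖((L : ℂ))⁻¹ • cDv N Rc lam y μ + err2v L N Rc lam y j μ‖ ^ 2
      = (L : ℝ) ^ d * (((L : ℝ))⁻¹ ^ 2 * ‖G y‖ ^ 2) + ∑ j : Fin d → Fin L, ‖err2v L N Rc lam y j μ‖ ^ 2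
        + 2 * (c * (((L : ℝ))⁻¹ * (⟪G y, DD μ y⟫_ℂ).re)) := by
    intro y
    have ha : ‖((L : ℂ))⁻¹ • cDv N Rc lam y μ‖ ^ 2 = ((L : ℝ))⁻¹ ^ 2 * ‖G y‖ ^ 2 := by
      rw [norm_smul, norm_inv, Complex.norm_natCast, mul_pow]
    have hmain : ∑ _j : Fin d → Fin L, ‖((L : ℂ))⁻¹ • cDv N Rc lam y μ‖ ^ 2 = (L : ℝ) ^ d * (((L : ℝ))⁻¹ ^ 2 * ‖G y‖ ^ 2) := by
      rw [Finset.sum_const, nsmul_eq_mul, hcard, ha]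
    have hcr : ∑ j : Fin d → Fin L, 2 * (⟪((L : ℂ))⁻¹ • cDv N Rc lam y μ, err2v L N Rc lam y j μ⟫_ℂ).re
        = 2 * (c * (((L : ℝ))⁻¹ * (⟪G y, DD μ y⟫_ℂ).re)) := by
      rw [← Finset.mul_sum, ← Complex.re_sum, ← inner_sum, sum_err2v L N Rc lam y μ, inner_smul_right, inner_smul_left, map_inv₀,
        Complex.conj_natCast]
      congr 1
      have e : ((((L : ℝ) ^ (d - 1) * wt L 0 : ℝ)) : ℂ) * (((L : ℂ))⁻¹ * ⟪cDv N Rc lam y μ, cDv N Rc (fun z => cDv N Rc lam z μ) y μ⟫_ℂ)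
          = ((c : ℝ) : ℂ) * ((((L : ℝ)⁻¹ : ℝ) : ℂ) * ⟪G y, DD μ y⟫_ℂ) := by
        simp only [hG, hDD, hc]; push_cast; ring
      rw [e, Complex.re_ofReal_mul, Complex.re_ofReal_mul]
    simp_rw [@norm_add_sq ℂ, RCLike.re_to_complex]
    rw [Finset.sum_add_distrib, Finset.sum_add_distrib, hmain, hcr]
    ring
  -- sum over blocks
  rw [Finset.sum_congr rfl fun y _ => hblock y, Finset.sum_add_distrib, Finset.sum_add_distrib, ← Finset.mul_sum, ← Finset.mul_sum,
    ← Finset.mul_sum, ← Finset.mul_sum, ← Finset.mul_sum, ← Complex.re_sum]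
  -- the cross term, exactly
  have hcross : (∑ y : Tor N, ⟪G y, DD μ y⟫_ℂ).re = -(1 / 2) * ∑ y, ‖DD μ y‖ ^ 2 := by
    simp only [hDDμ]
    exact re_sum_inner_cDv N μ hRc1 G
  rw [hcross]
  -- the pieces as the named sums
  have hX : ∑ y : Tor N, ‖G y‖ ^ 2 = dirUv N Rc lam μ := rfl
  have hH : ∀ ν, ∑ y : Tor N, ‖DD ν y‖ ^ 2 = dirUv N Rc (fun z => cDv N Rc lam z ν) μ := fun ν => rfl
  have hE : ∑ y : Tor N, ∑ j : Fin d → Fin L, ‖err2v L N Rc lam y j μ‖ ^ 2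
      ≤ (L : ℝ) ^ (d - 1) * ((d : ℝ) / 4 * ∑ ν, dirUv N Rc (fun z => cDv N Rc lam z ν) μ) := by
    calc ∑ y : Tor N, ∑ j : Fin d → Fin L, ‖err2v L N Rc lam y j μ‖ ^ 2
        ≤ ∑ y : Tor N, (L : ℝ) ^ (d - 1) * ((d : ℝ) / 4 * ∑ ν, ‖DD ν y‖ ^ 2) :=
          Finset.sum_le_sum fun y _ => sum_norm_err2v_sq_le L N Rc lam y μ
      _ = (L : ℝ) ^ (d - 1) * ((d : ℝ) / 4 * ∑ ν, dirUv N Rc (fun z => cDv N Rc lam z ν) μ) := by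
          rw [← Finset.mul_sum, ← Finset.mul_sum, Finset.sum_comm]
          simp only [hH]
  have hHμ : dirUv N Rc (fun z => cDv N Rc lam z μ) μ ≤ ∑ ν, dirUv N Rc (fun z => cDv N Rc lam z ν) μ :=
    Finset.single_le_sum (f := fun ν => dirUv N Rc (fun z => cDv N Rc lam z ν) μ) (fun ν _ => dirUv_nonneg _ _ _ _) (Finset.mem_univ μ)
  have hH0 : 0 ≤ dirUv N Rc (fun z => cDv N Rc lam z μ) μ := dirUv_nonneg _ _ _ _
  have hS0 : 0 ≤ ∑ ν, dirUv N Rc (fun z => cDv N Rc lam z ν) μ := Finset.sum_nonneg fun ν _ => dirUv_nonneg _ _ _ _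
  rw [hX, hH μ]
  -- cross coefficient: `2·c·L⁻¹·(−½)·H = (−w_L(0))·L^{d−1}·L⁻¹·H ≤ ½·L^{d−1}·H ≤ ½·(L^d∕L)·H`
  have hcrossle : 2 * (c * (((L : ℝ))⁻¹ * (-(1 / 2) * dirUv N Rc (fun z => cDv N Rc lam z μ) μ)))
      ≤ 1 / 2 * ((L : ℝ) ^ d / L) * ∑ ν, dirUv N Rc (fun z => cDv N Rc lam z ν) μ := by
    have e : 2 * (c * (((L : ℝ))⁻¹ * (-(1 / 2) * dirUv N Rc (fun z => cDv N Rc lam z μ) μ)))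
        = (-wt L 0) * (((L : ℝ) ^ (d - 1) * ((L : ℝ))⁻¹) * dirUv N Rc (fun z => cDv N Rc lam z μ) μ) := by
      simp only [hc]; ring
    rw [e]
    have hLinv : ((L : ℝ))⁻¹ ≤ 1 := inv_le_one_of_one_le₀ (by exact_mod_cast hL1)
    have h1 : (L : ℝ) ^ (d - 1) * ((L : ℝ))⁻¹ ≤ (L : ℝ) ^ d / L := by
      rw [hpow]
      exact mul_le_of_le_one_right (by positivity) hLinv
    calc (-wt L 0) * (((L : ℝ) ^ (d - 1) * ((L : ℝ))⁻¹) * dirUv N Rc (fun z => cDv N Rc lam z μ) μ)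
        ≤ 1 / 2 * (((L : ℝ) ^ d / L) * ∑ ν, dirUv N Rc (fun z => cDv N Rc lam z ν) μ) :=
          mul_le_mul hw1 (mul_le_mul h1 hHμ hH0 (by positivity)) (by positivity) (by norm_num)
      _ = _ := by ring
  have hmain : (L : ℝ) ^ d * (((L : ℝ))⁻¹ ^ 2 * dirUv N Rc lam μ) = (L : ℝ) ^ d / (L : ℝ) ^ 2 * dirUv N Rc lam μ := by
    rw [inv_pow]; ring
  rw [hpow] at hE
  calc _ ≤ (L : ℝ) ^ d / (L : ℝ) ^ 2 * dirUv N Rc lam μ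
        + (L : ℝ) ^ d / L * ((d : ℝ) / 4 * ∑ ν, dirUv N Rc (fun z => cDv N Rc lam z ν) μ)
        + 1 / 2 * ((L : ℝ) ^ d / L) * ∑ ν, dirUv N Rc (fun z => cDv N Rc lam z ν) μ :=
        add_le_add (add_le_add hmain.le hE) hcrossle
    _ = _ := by ring

variable {Rc lam}

/-- **LEAF V-COL-ONE, per direction (lattice units)**: unitary `T′`, unitary `Rc`, the two FRAME defects `≤ m`:
`dirUv (fine L N) R′ Λ′ μ ≤ ( √(L^d∕L²·X_μ + (d∕4 + 1∕2)·L^d∕L·HESS_μ) + m·√(2(1+d²)·L^d·Σ‖λ‖²) )²`. [folklore] -/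
theorem dirUv_interpv_le {T' : Tor (fine L N) → (E →L[ℂ] E)} (hT1 : ∀ x, T' x ∈ unitary (E →L[ℂ] E))
    (hRc1 : ∀ y μ, Rc y μ ∈ unitary (E →L[ℂ] E)) {R' : Tor (fine L N) → Fin d → (E →L[ℂ] E)} {m : ℝ} (hm : 0 ≤ m)
    (hin : ∀ (y : Tor N) (j : Fin d → Fin L) (μ : Fin d), (j μ : ℕ) + 1 < L →
      ‖R' (bpt L N y j) μ * star (T' (bpt L N y j + unitVec (fine L N) μ)) - star (T' (bpt L N y j))‖ ≤ m)
    (hcross : ∀ (y : Tor N) (j : Fin d → Fin L) (μ : Fin d), (j μ : ℕ) + 1 = L →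
      ‖R' (bpt L N y j) μ * star (T' (bpt L N y j + unitVec (fine L N) μ)) - star (T' (bpt L N y j)) * Rc y μ‖ ≤ m)
    (μ : Fin d) :
    dirUv (fine L N) R' (interpv L N T' Rc lam) μ
      ≤ (Real.sqrt ((L : ℝ) ^ d / (L : ℝ) ^ 2 * dirUv N Rc lam μ
            + ((d : ℝ) / 4 + 1 / 2) * ((L : ℝ) ^ d / L) * ∑ ν, dirUv N Rc (fun z => cDv N Rc lam z ν) μ)
          + m * Real.sqrt (2 * (1 + (d : ℝ) ^ 2) * ((L : ℝ) ^ d * ∑ y, ‖lam y‖ ^ 2))) ^ 2 := by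
  have hRc : ∀ y μ, ‖Rc y μ‖ ≤ 1 := fun y μ => norm_le_one_of_mem_unitary (hRc1 y μ)
  set A : Tor N × (Fin d → Fin L) → ℝ := fun p => ‖((L : ℂ))⁻¹ • cDv N Rc lam p.1 μ + err2v L N Rc lam p.1 p.2 μ‖ with hA
  set B : Tor N × (Fin d → Fin L) → ℝ := fun p => ‖PhiFv L N Rc lam (bpt L N p.1 p.2 + unitVec (fine L N) μ)‖ with hB
  have hpt : ∀ p : Tor N × (Fin d → Fin L),
      ‖cDv (fine L N) R' (interpv L N T' Rc lam) (bpt L N p.1 p.2) μ‖ ^ 2 ≤ (A p + m * B p) ^ 2 := fun p =>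
    pow_le_pow_left₀ (norm_nonneg _) (norm_cDv_interpv_le L N Rc lam hT1 hin hcross p.1 p.2 μ) 2
  have hsum : dirUv (fine L N) R' (interpv L N T' Rc lam) μ ≤ ∑ p : Tor N × (Fin d → Fin L), (A p + m * B p) ^ 2 := by
    unfold dirUv
    rw [sum_blocks_real L N (fun x => ‖cDv (fine L N) R' (interpv L N T' Rc lam) x μ‖ ^ 2), ← Fintype.sum_prod_type']
    exact Finset.sum_le_sum fun p _ => hpt p
  have hmink := sum_sq_add_le (Finset.univ : Finset (Tor N × (Fin d → Fin L))) A B hm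
  have hA2 : ∑ p : Tor N × (Fin d → Fin L), A p ^ 2
      ≤ (L : ℝ) ^ d / (L : ℝ) ^ 2 * dirUv N Rc lam μ
        + ((d : ℝ) / 4 + 1 / 2) * ((L : ℝ) ^ d / L) * ∑ ν, dirUv N Rc (fun z => cDv N Rc lam z ν) μ := by
    rw [Fintype.sum_prod_type]
    exact sum_geo_sq_le L N Rc lam μ (fun y => hRc1 y μ)
  have hB2 : ∑ p : Tor N × (Fin d → Fin L), B p ^ 2 ≤ 2 * (1 + (d : ℝ) ^ 2) * ((L : ℝ) ^ d * ∑ y, ‖lam y‖ ^ 2) := by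
    have e : ∑ p : Tor N × (Fin d → Fin L), B p ^ 2 = ∑ x, ‖PhiFv L N Rc lam x‖ ^ 2 := by
      rw [Fintype.sum_prod_type]
      simp only [hB]
      rw [← sum_blocks_real L N (fun x => ‖PhiFv L N Rc lam (x + unitVec (fine L N) μ)‖ ^ 2)]
      exact Fintype.sum_equiv (Equiv.addRight (unitVec (fine L N) μ)) _ _ fun x => rfl
    rw [e]
    exact sum_norm_sq_PhiFv_le L N Rc lam hRc
  have hsA : Real.sqrt (∑ p : Tor N × (Fin d → Fin L), A p ^ 2)
      ≤ Real.sqrt ((L : ℝ) ^ d / (L : ℝ) ^ 2 * dirUv N Rc lam μ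
          + ((d : ℝ) / 4 + 1 / 2) * ((L : ℝ) ^ d / L) * ∑ ν, dirUv N Rc (fun z => cDv N Rc lam z ν) μ) := Real.sqrt_le_sqrt hA2
  have hsB : Real.sqrt (∑ p : Tor N × (Fin d → Fin L), B p ^ 2) ≤ Real.sqrt (2 * (1 + (d : ℝ) ^ 2) * ((L : ℝ) ^ d * ∑ y, ‖lam y‖ ^ 2)) :=
    Real.sqrt_le_sqrt hB2
  have h0 : 0 ≤ Real.sqrt (∑ p : Tor N × (Fin d → Fin L), A p ^ 2) + m * Real.sqrt (∑ p : Tor N × (Fin d → Fin L), B p ^ 2) := by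
    positivity
  calc dirUv (fine L N) R' (interpv L N T' Rc lam) μ ≤ _ := hsum
    _ ≤ _ := hmink
    _ ≤ _ := pow_le_pow_left₀ h0 (add_le_add hsA (mul_le_mul_of_nonneg_left hsB hm)) 2

/-- **LEAF V-COL-ONE (lattice units)**: the colour covariant Dirichlet sum of the competitor `Λ′` over the fine torus,
`Σ_μ dirUv (fine L N) R′ Λ′ μ ≤ ( √(L^d∕L²·X + (d∕4 + 1∕2)·L^d∕L·HESS) + √d·m·√(2(1+d²)·L^d·Σ‖λ‖²) )²`
with `X = Σ_μ dirUv N Rc λ μ` (MAIN TERM, constant EXACTLY 1 after the physical prefactors) and `HESS = hessv N Rc λ`. [folklore] -/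
theorem sum_dirUv_interpv_le {T' : Tor (fine L N) → (E →L[ℂ] E)} (hT1 : ∀ x, T' x ∈ unitary (E →L[ℂ] E))
    (hRc1 : ∀ y μ, Rc y μ ∈ unitary (E →L[ℂ] E)) {R' : Tor (fine L N) → Fin d → (E →L[ℂ] E)} {m : ℝ} (hm : 0 ≤ m)
    (hin : ∀ (y : Tor N) (j : Fin d → Fin L) (μ : Fin d), (j μ : ℕ) + 1 < L →
      ‖R' (bpt L N y j) μ * star (T' (bpt L N y j + unitVec (fine L N) μ)) - star (T' (bpt L N y j))‖ ≤ m)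
    (hcross : ∀ (y : Tor N) (j : Fin d → Fin L) (μ : Fin d), (j μ : ℕ) + 1 = L →
      ‖R' (bpt L N y j) μ * star (T' (bpt L N y j + unitVec (fine L N) μ)) - star (T' (bpt L N y j)) * Rc y μ‖ ≤ m) :
    ∑ μ, dirUv (fine L N) R' (interpv L N T' Rc lam) μ
      ≤ (Real.sqrt ((L : ℝ) ^ d / (L : ℝ) ^ 2 * (∑ μ, dirUv N Rc lam μ) + ((d : ℝ) / 4 + 1 / 2) * ((L : ℝ) ^ d / L) * hessv N Rc lam)
          + Real.sqrt d * (m * Real.sqrt (2 * (1 + (d : ℝ) ^ 2) * ((L : ℝ) ^ d * ∑ y, ‖lam y‖ ^ 2)))) ^ 2 := by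
  have hb0 : 0 ≤ m * Real.sqrt (2 * (1 + (d : ℝ) ^ 2) * ((L : ℝ) ^ d * ∑ y, ‖lam y‖ ^ 2)) := mul_nonneg hm (Real.sqrt_nonneg _)
  have hA0 : ∀ μ : Fin d, 0 ≤ (L : ℝ) ^ d / (L : ℝ) ^ 2 * dirUv N Rc lam μ
      + ((d : ℝ) / 4 + 1 / 2) * ((L : ℝ) ^ d / L) * ∑ ν, dirUv N Rc (fun z => cDv N Rc lam z ν) μ := fun μ =>
    add_nonneg (mul_nonneg (by positivity) (dirUv_nonneg _ _ _ _))
      (mul_nonneg (by positivity) (Finset.sum_nonneg fun ν _ => dirUv_nonneg _ _ _ _))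
  have hsumA : ∑ μ : Fin d, Real.sqrt ((L : ℝ) ^ d / (L : ℝ) ^ 2 * dirUv N Rc lam μ
        + ((d : ℝ) / 4 + 1 / 2) * ((L : ℝ) ^ d / L) * ∑ ν, dirUv N Rc (fun z => cDv N Rc lam z ν) μ) ^ 2
      = (L : ℝ) ^ d / (L : ℝ) ^ 2 * (∑ μ, dirUv N Rc lam μ) + ((d : ℝ) / 4 + 1 / 2) * ((L : ℝ) ^ d / L) * hessv N Rc lam := by
    rw [Finset.sum_congr rfl fun μ _ => Real.sq_sqrt (hA0 μ), Finset.sum_add_distrib, ← Finset.mul_sum, ← Finset.mul_sum]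
    rfl
  calc ∑ μ, dirUv (fine L N) R' (interpv L N T' Rc lam) μ
      ≤ ∑ μ : Fin d, (Real.sqrt ((L : ℝ) ^ d / (L : ℝ) ^ 2 * dirUv N Rc lam μ
            + ((d : ℝ) / 4 + 1 / 2) * ((L : ℝ) ^ d / L) * ∑ ν, dirUv N Rc (fun z => cDv N Rc lam z ν) μ)
          + m * Real.sqrt (2 * (1 + (d : ℝ) ^ 2) * ((L : ℝ) ^ d * ∑ y, ‖lam y‖ ^ 2))) ^ 2 :=
        Finset.sum_le_sum fun μ _ => dirUv_interpv_le L N hT1 hRc1 hm hin hcross μ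
    _ ≤ _ := sum_fin_sq_add_le _ hb0
    _ = _ := by rw [hsumA]

/-- **LEAF V-COL-ONE, `∃`-form (lattice units)**: a fine field meeting the transported constraint EXACTLY with the bound above. [folklore] -/
theorem exists_oneStep_lattice_colour {T' : Tor (fine L N) → (E →L[ℂ] E)} (hT1 : ∀ x, T' x ∈ unitary (E →L[ℂ] E))
    (hRc1 : ∀ y μ, Rc y μ ∈ unitary (E →L[ℂ] E)) {R' : Tor (fine L N) → Fin d → (E →L[ℂ] E)} {m : ℝ} (hm : 0 ≤ m)
    (hin : ∀ (y : Tor N) (j : Fin d → Fin L) (μ : Fin d), (j μ : ℕ) + 1 < L →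
      ‖R' (bpt L N y j) μ * star (T' (bpt L N y j + unitVec (fine L N) μ)) - star (T' (bpt L N y j))‖ ≤ m)
    (hcross : ∀ (y : Tor N) (j : Fin d → Fin L) (μ : Fin d), (j μ : ℕ) + 1 = L →
      ‖R' (bpt L N y j) μ * star (T' (bpt L N y j + unitVec (fine L N) μ)) - star (T' (bpt L N y j)) * Rc y μ‖ ≤ m) :
    ∃ f' : Tor (fine L N) → E, (fun y => Qcv L N T' f' y) = lam ∧
      ∑ μ, dirUv (fine L N) R' f' μ
        ≤ (Real.sqrt ((L : ℝ) ^ d / (L : ℝ) ^ 2 * (∑ μ, dirUv N Rc lam μ) + ((d : ℝ) / 4 + 1 / 2) * ((L : ℝ) ^ d / L) * hessv N Rc lam)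
            + Real.sqrt d * (m * Real.sqrt (2 * (1 + (d : ℝ) ^ 2) * ((L : ℝ) ^ d * ∑ y, ‖lam y‖ ^ 2)))) ^ 2 :=
  ⟨interpv L N T' Rc lam, Qcv_interpv L N Rc lam hT1, sum_dirUv_interpv_le L N hT1 hRc1 hm hin hcross⟩

end Lattice

end Summit.QuantumFields.BalabanUV.T4Continuum.VariationalColourOneStep

end
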